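import Summits.QuantumFields.BalabanUV.Beta.CompositeAveragingCoarseExactGenericGauge

/-!
# `BalabanUV.Beta.CompositeCorrectorFormsGeneric` — binder row D1 ∕ (C1): **THE COMPOSITE CORRECTOR PAIR IS SCHEME-GENERIC** — an2 g24's `CompositeCorrectorForms` §4–§5
# (`corrPhi ∕ corrPsi`: mutually inverse, re-linearising the straight row to the composite one, slice-preserving, curvature-flat) re-proved for ANY one-step averaging family
# from four one-step letters (coarse-exact defect, subtractivity ×2, nilpotency) (§1), and INSTANTIATED at the (0.4)-SYMMETRISED scheme (§2): **`corrPhiSym` ∕ `corrPsiSym`**,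
# **`corrPsiSym_corrPhiSym`**, **`corrPhiSym_corrPsiSym`**, **`contourSum_corrPhiSym`** (`= compLinAvgSymAt`), slice preservation, flatness — K-U3d-sym's THIRD form-level brick:
# the FORM-LEVEL (0.4) composite corrector that road XREAD-L v1.3 displays as `Ψs`∕`Φs` (row OWNER an2 gen 89; sequel of PART 124∕125)

WHAT ([folklore] finite-difference algebra; four bookkeeping `def`s [our object]; nothing cited, no `Prop` fact):
* §1 GENERIC (`Av`, `lam`, `L`, scalar `c`): subtractivity `compAvOf_sub`∕`compDefectOf_sub` from the one-step letters (S) `Av k (A − B) = Av k A − Av k B`, (S′) `lam k (A − B) = lam k A − lam k B`;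
  [our object] `corrPhiOf Av lam L m A := A − |box (L^m)|⁻¹ • dz (ext (L^m) (compDefectOf Av lam L m A))`, `corrPsiOf … := A + …`; `compDefectOf_corr_term` (the potential does not see
  the correction term — nilpotency (E)(Z) of PART 125), `compDefectOf_corrPhiOf ∕ _corrPsiOf`, **`corrPsiOf_corrPhiOf`**, **`corrPhiOf_corrPsiOf`** (MUTUALLY INVERSE),
  **`contourSum_corrPhiOf`** (`contourSum (L^m) (Φ A) = compAvOf Av m A` — RE-LINEARISATION, from the coarse-exact defect letter `hdef` of PART 124), `axialGaugeAt_corrPhiOf_sub ∕ _corrPsiOf_sub`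
  (SLICE PRESERVATION: `Φ A − A`, `Ψ A − A` are rooted-axial at scale `L^m`), `curv_corrPhiOf ∕ curv_corrPsiOf` (FLATNESS).
* §2 THE (0.4) INSTANCE (in-block roots `ρs k = toSite (r k)`): the four letters DISCHARGED — `avSym_sub` (new: `symLinAvgAt` is subtractive, via `symLinAvgAt_eq_contourSum_sub_dz`,
  `SymLamAt_sub`), `lamSym_sub` (`zetaS_sub`), PART 124's `contourSum_sub_avSym`, PART 125's `avSym_dz_ext_succ`∕`zetaS_dz_ext_succ`; [our objects] **`corrPhiSym r L m`**, **`corrPsiSym r L m`**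
  and the six theorems above at the sym data: `corrPsiSym_corrPhiSym`, `corrPhiSym_corrPsiSym`, `contourSum_corrPhiSym : contourSum (L^m) (corrPhiSym r L m A) = compLinAvgSymAt … m A`,
  `axialGaugeAt_corrPhiSym_sub ∕ _corrPsiSym_sub`, `curv_corrPhiSym ∕ curv_corrPsiSym`.
WHY: these are EXACTLY the form-level identities K-U3d's kernelisation (`CompositeCorrectorKernel`∕`…Spr`∕`…Slot`) and congruence (`RelInvCongruence[Kernel]`, `RelInvCompositeSocket.relInv_composite_of_corrector`)
consumed for the record's ROOTED `corrPsi` — so the (0.4) composite corrector `Ψs m := kerOf (corrPsiSym r L m)` and four of XREAD-L v1.3's seven displayed letter families (`hΨΦ hΦΨ`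
from mutual inversion, `hEΨ hEΦ` from slice preservation, after kernelisation) are now re-instantiations of existing files; what stays NEW for L by name is the null row (`hnull`: the
(0.4) composite rows vs the congruence border — `contourSum_corrPhiSym` is its form-level half), the slot transport∕adjunction at the sym corrector, and `Spr`∕decay (kernel files).
HONEST: lattice algebra BY NAME; nothing of Bałaban's asserted, valued or discharged; L NOT commissioned (the referee's∕planner's decision); no END row discharged; the literal of record,
ROOT M‴ ∕ P5c ∕ D6, v10 + END v3 + W untouched; 0∕4 row-D1 binders; NOT (C1), NOT (T-ID), NOT D1, NEVER «G-an2-4 closed», NOT BetaPertH, NOT continuum, NOT Clay.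
HONEST DEPENDENCY (page 1, mandatory): continuum YM on T⁴ ⇐ BetaPertH ∧ nine spine estimates (0/9 proved); BetaPertH ⇐ (D1) ∧ (D4) ∧ CAP+tail; G-an2-4 gates asym, D1 and NE2/3/4.
Row D1 ∕ (C1) OWNER an2, gen 89, 2026-08-30; the namespace of PART 124 is reopened on purpose (chair XV5 INFO); no existing file touched.
-/

namespace Summit.QuantumFields.BalabanUV.Beta.CompositeAveragingCoarseExactGeneric

open Finset
open scoped BigOperators Nat
open Literature.MathematicalPhysics.QuantumFieldTheory.Balaban1983to89.Beta
open AffineAveraging (Site Form0 Form1 box toSite unitVec dz curv blockSum contourSum contourSum_dz curv_dz)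
open AveragingContoursRooted (AxialGaugeAt)
open AffineReproduction (contourSum_sub)
open Summit.QuantumFields.BalabanUV.Beta.SymmetrisedAxialPotential (SymLamAt symLinAvgAt symLinAvgAt_eq_contourSum_sub_dz)
open Summit.QuantumFields.BalabanUV.Beta.SymCorrectorForms (zetaS SymLamAt_sub zetaS_sub)
open Summit.QuantumFields.BalabanUV.Beta.CompositeCorrectorForms (ext blockSum_ext axialGaugeAt_dz_ext smul_dz_ext contourSum_smul' curv_sub_smul_dz blockSum_sub)

noncomputable section

variable {d : ℕ}

/-! ## §1 Generic: subtractivity, the corrector pair, mutual inversion, re-linearisation, slice, flatness -/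

section Generic

variable (Av : ℕ → Form1 d ℝ → Form1 d ℝ) (lam : ℕ → Form1 d ℝ → Form0 d ℝ) (L : ℕ)

/-- [folklore] **THE COMPOSITE IS SUBTRACTIVE** under the one-step letter (S). -/
theorem compAvOf_sub (hS : ∀ (k : ℕ) (A B : Form1 d ℝ), Av k (A - B) = Av k A - Av k B) (A B : Form1 d ℝ) :
    ∀ m, compAvOf Av m (A - B) = compAvOf Av m A - compAvOf Av m B
  | 0 => rfl
  | m + 1 => by rw [compAvOf_succ, compAvOf_succ, compAvOf_succ, compAvOf_sub hS A B m, hS]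

/-- [folklore] **THE DEFECT POTENTIAL IS SUBTRACTIVE** under (S)(S′). -/
theorem compDefectOf_sub (hS : ∀ (k : ℕ) (A B : Form1 d ℝ), Av k (A - B) = Av k A - Av k B)
    (hS' : ∀ (k : ℕ) (A B : Form1 d ℝ), lam k (A - B) = lam k A - lam k B) (A B : Form1 d ℝ) :
    ∀ m, compDefectOf Av lam L m (A - B) = compDefectOf Av lam L m A - compDefectOf Av lam L m B
  | 0 => by simp [compDefectOf]
  | m + 1 => by
      rw [compDefectOf_succ, compDefectOf_succ, compDefectOf_succ, compDefectOf_sub hS hS' A B m, compAvOf_sub Av hS, hS', blockSum_sub]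
      abel

/-- [our object — bookkeeping] **THE GENERIC CORRECTOR ON THE BORDER SIDE**: `Φ_m A := A − |box (L^m)|⁻¹ • dz (ext (L^m) (ζ_m A))`, `ζ_m := compDefectOf Av lam L m`. -/
def corrPhiOf (m : ℕ) (A : Form1 d ℝ) : Form1 d ℝ :=
  A - ((box d (L ^ m)).card : ℝ)⁻¹ • dz (ext (L ^ m) (compDefectOf Av lam L m A))

/-- [our object — bookkeeping] **ITS INVERSE (the dressing-side corrector)**: `Ψ_m A := A + |box (L^m)|⁻¹ • dz (ext (L^m) (ζ_m A))`. -/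
def corrPsiOf (m : ℕ) (A : Form1 d ℝ) : Form1 d ℝ :=
  A + ((box d (L ^ m)).card : ℝ)⁻¹ • dz (ext (L ^ m) (compDefectOf Av lam L m A))

variable {Av lam L}

/-- [folklore] The potential does not see the correction term: `ζ_m (a • dz (ext (L^m) h)) = 0` — from the nilpotency letters (E)(Z) of PART 125. -/
theorem compDefectOf_corr_term {c : ℝ} (hE : ∀ (k j : ℕ) (g : Form0 d ℝ), Av k (dz (ext (L ^ (j + 1)) g)) = dz (ext (L ^ j) (c • g)))
    (hZ : ∀ (k j : ℕ) (g : Form0 d ℝ), lam k (dz (ext (L ^ (j + 1)) g)) = 0) (m : ℕ) (a : ℝ) (h : Form0 d ℝ) :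
    compDefectOf Av lam L m (a • dz (ext (L ^ m) h)) = 0 := by
  rw [smul_dz_ext, compDefectOf_dz_ext_self Av lam L c hE hZ]

/-- [folklore] `ζ_m (Φ_m A) = ζ_m A`. -/
theorem compDefectOf_corrPhiOf {c : ℝ} (hS : ∀ (k : ℕ) (A B : Form1 d ℝ), Av k (A - B) = Av k A - Av k B)
    (hS' : ∀ (k : ℕ) (A B : Form1 d ℝ), lam k (A - B) = lam k A - lam k B)
    (hE : ∀ (k j : ℕ) (g : Form0 d ℝ), Av k (dz (ext (L ^ (j + 1)) g)) = dz (ext (L ^ j) (c • g)))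
    (hZ : ∀ (k j : ℕ) (g : Form0 d ℝ), lam k (dz (ext (L ^ (j + 1)) g)) = 0) (m : ℕ) (A : Form1 d ℝ) :
    compDefectOf Av lam L m (corrPhiOf Av lam L m A) = compDefectOf Av lam L m A := by
  rw [corrPhiOf, compDefectOf_sub Av lam L hS hS', compDefectOf_corr_term hE hZ, sub_zero]

/-- [folklore] `ζ_m (Ψ_m A) = ζ_m A`. -/
theorem compDefectOf_corrPsiOf {c : ℝ} (hS : ∀ (k : ℕ) (A B : Form1 d ℝ), Av k (A - B) = Av k A - Av k B)
    (hS' : ∀ (k : ℕ) (A B : Form1 d ℝ), lam k (A - B) = lam k A - lam k B)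
    (hE : ∀ (k j : ℕ) (g : Form0 d ℝ), Av k (dz (ext (L ^ (j + 1)) g)) = dz (ext (L ^ j) (c • g)))
    (hZ : ∀ (k j : ℕ) (g : Form0 d ℝ), lam k (dz (ext (L ^ (j + 1)) g)) = 0) (m : ℕ) (A : Form1 d ℝ) :
    compDefectOf Av lam L m (corrPsiOf Av lam L m A) = compDefectOf Av lam L m A := by
  have h : corrPsiOf Av lam L m A = A - (-(((box d (L ^ m)).card : ℝ)⁻¹) • dz (ext (L ^ m) (compDefectOf Av lam L m A))) := by
    rw [corrPsiOf, neg_smul, sub_neg_eq_add]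
  rw [h, compDefectOf_sub Av lam L hS hS', compDefectOf_corr_term hE hZ, sub_zero]

/-- [folklore] **MUTUALLY INVERSE (I)**: `Ψ_m (Φ_m A) = A`. -/
theorem corrPsiOf_corrPhiOf {c : ℝ} (hS : ∀ (k : ℕ) (A B : Form1 d ℝ), Av k (A - B) = Av k A - Av k B)
    (hS' : ∀ (k : ℕ) (A B : Form1 d ℝ), lam k (A - B) = lam k A - lam k B)
    (hE : ∀ (k j : ℕ) (g : Form0 d ℝ), Av k (dz (ext (L ^ (j + 1)) g)) = dz (ext (L ^ j) (c • g)))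
    (hZ : ∀ (k j : ℕ) (g : Form0 d ℝ), lam k (dz (ext (L ^ (j + 1)) g)) = 0) (m : ℕ) (A : Form1 d ℝ) :
    corrPsiOf Av lam L m (corrPhiOf Av lam L m A) = A := by
  rw [corrPsiOf, compDefectOf_corrPhiOf hS hS' hE hZ, corrPhiOf, sub_add_cancel]

/-- [folklore] **MUTUALLY INVERSE (II)**: `Φ_m (Ψ_m A) = A`. -/
theorem corrPhiOf_corrPsiOf {c : ℝ} (hS : ∀ (k : ℕ) (A B : Form1 d ℝ), Av k (A - B) = Av k A - Av k B)
    (hS' : ∀ (k : ℕ) (A B : Form1 d ℝ), lam k (A - B) = lam k A - lam k B)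
    (hE : ∀ (k j : ℕ) (g : Form0 d ℝ), Av k (dz (ext (L ^ (j + 1)) g)) = dz (ext (L ^ j) (c • g)))
    (hZ : ∀ (k j : ℕ) (g : Form0 d ℝ), lam k (dz (ext (L ^ (j + 1)) g)) = 0) (m : ℕ) (A : Form1 d ℝ) :
    corrPhiOf Av lam L m (corrPsiOf Av lam L m A) = A := by
  rw [corrPhiOf, compDefectOf_corrPsiOf hS hS' hE hZ, corrPsiOf, add_sub_cancel_right]

/-- [folklore] **RE-LINEARISATION OF THE BORDER, GENERIC**: `contourSum (L^m) (Φ_m A) = compAvOf Av m A` — the straight row of the corrected field IS the composite averaging of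
the field (`0 < L`; from the coarse-exact defect letter `hdef`). -/
theorem contourSum_corrPhiOf (hL : 0 < L) (hdef : ∀ (k : ℕ) (B : Form1 d ℝ) (μ : Fin d) (Y : Site d), contourSum L B μ Y - Av k B μ Y = dz (lam k B) μ Y)
    (m : ℕ) (A : Form1 d ℝ) : contourSum (L ^ m) (corrPhiOf Av lam L m A) = compAvOf Av m A := by
  have hcard : ((box d (L ^ m)).card : ℝ) ≠ 0 := by
    have : 0 < (box d (L ^ m)).card := by
      rw [Finset.card_pos]
      exact ⟨fun _ => 0, Fintype.mem_piFinset.2 fun _ => Finset.mem_range.2 (pow_pos hL m)⟩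
    exact_mod_cast this.ne'
  rw [corrPhiOf, contourSum_sub, contourSum_smul', contourSum_dz, blockSum_ext, contourSum_pow_eq_compAvOf_add_dz Av lam L hL hdef A m]
  have e : ((box d (L ^ m)).card : ℝ)⁻¹ • dz (((box d (L ^ m)).card : ℝ) • compDefectOf Av lam L m A) = dz (compDefectOf Av lam L m A) := by
    funext κ y; simp only [Pi.smul_apply, dz, smul_eq_mul]; field_simp
  rw [e, add_sub_cancel_right]

variable (Av lam L)

/-- [folklore] **SLICE PRESERVATION (Φ)**: `Φ_m A − A` is rooted-axial at scale `L^m` for any in-block root. -/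
theorem axialGaugeAt_corrPhiOf_sub (m : ℕ) {s : Fin d → ℕ} (hs : s ∈ box d (L ^ m)) (A : Form1 d ℝ) :
    AxialGaugeAt (toSite s) (corrPhiOf Av lam L m A - A) (L ^ m) := by
  intro y b hb
  have h := axialGaugeAt_dz_ext hs (-(((box d (L ^ m)).card : ℝ)⁻¹) • compDefectOf Av lam L m A) y b hb
  rw [← smul_dz_ext] at h
  have e : corrPhiOf Av lam L m A - A = (-(((box d (L ^ m)).card : ℝ)⁻¹)) • dz (ext (L ^ m) (compDefectOf Av lam L m A)) := by
    rw [corrPhiOf, neg_smul]; abel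
  rw [e]; exact h

/-- [folklore] **SLICE PRESERVATION (Ψ)**: `Ψ_m A − A` is rooted-axial at scale `L^m`. -/
theorem axialGaugeAt_corrPsiOf_sub (m : ℕ) {s : Fin d → ℕ} (hs : s ∈ box d (L ^ m)) (A : Form1 d ℝ) :
    AxialGaugeAt (toSite s) (corrPsiOf Av lam L m A - A) (L ^ m) := by
  intro y b hb
  have h := axialGaugeAt_dz_ext hs ((((box d (L ^ m)).card : ℝ)⁻¹) • compDefectOf Av lam L m A) y b hb
  rw [← smul_dz_ext] at h
  have e : corrPsiOf Av lam L m A - A = (((box d (L ^ m)).card : ℝ)⁻¹) • dz (ext (L ^ m) (compDefectOf Av lam L m A)) := by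
    rw [corrPsiOf]; abel
  rw [e]; exact h

/-- [folklore] **FLATNESS (Φ)**: `curv (Φ_m A) = curv A`. -/
theorem curv_corrPhiOf (m : ℕ) (A : Form1 d ℝ) : curv (corrPhiOf Av lam L m A) = curv A := by
  rw [corrPhiOf]; exact curv_sub_smul_dz A _ _

/-- [folklore] **FLATNESS (Ψ)**: `curv (Ψ_m A) = curv A`. -/
theorem curv_corrPsiOf (m : ℕ) (A : Form1 d ℝ) : curv (corrPsiOf Av lam L m A) = curv A := by
  have h : corrPsiOf Av lam L m A = A - (-(((box d (L ^ m)).card : ℝ)⁻¹)) • dz (ext (L ^ m) (compDefectOf Av lam L m A)) := by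
    rw [corrPsiOf, neg_smul, sub_neg_eq_add]
  rw [h]; exact curv_sub_smul_dz A _ _

end Generic

/-! ## §2 The (0.4)-symmetrised instance: the composite (0.4) corrector pair -/

section Sym

/-- [folklore] **THE (0.4) ONE-STEP MEAN IS SUBTRACTIVE** (letter (S) for the sym scheme; `symLinAvgAt_eq_contourSum_sub_dz`, `contourSum_sub`, `SymLamAt_sub`). -/
theorem avSym_sub (ρs : ℕ → Site d) (L : ℕ) (k : ℕ) (A B : Form1 d ℝ) : avSym ρs L k (A - B) = avSym ρs L k A - avSym ρs L k B := by
  funext μ y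
  simp only [Pi.sub_apply, avSym_apply, symLinAvgAt_eq_contourSum_sub_dz, contourSum_sub, SymLamAt_sub, dz]
  ring

/-- [folklore] **THE (0.4) POTENTIAL IS SUBTRACTIVE** (letter (S′); `zetaS_sub`). -/
theorem lamSym_sub (ρs : ℕ → Site d) (L : ℕ) (k : ℕ) (A B : Form1 d ℝ) : lamSym ρs L k (A - B) = lamSym ρs L k A - lamSym ρs L k B := by
  rw [lamSym_apply, lamSym_apply, lamSym_apply, zetaS_sub]

variable (r : ℕ → (Fin d → ℕ)) (L : ℕ)

/-- [our object — bookkeeping] **THE COMPOSITE (0.4) CORRECTOR ON THE BORDER SIDE**: `Φˢ_m := corrPhiOf (avSym ρs L) (lamSym ρs L) L m`, `ρs k = toSite (r k)` —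
`A − |box (L^m)|⁻¹ • dz (ext (L^m) (compDefectSymAt … m A))`. -/
def corrPhiSym (m : ℕ) (A : Form1 d ℝ) : Form1 d ℝ := corrPhiOf (avSym (fun k => toSite (r k)) L) (lamSym (fun k => toSite (r k)) L) L m A

/-- [our object — bookkeeping] **ITS INVERSE, THE DRESSING-SIDE (0.4) CORRECTOR**: `Ψˢ_m := corrPsiOf (avSym ρs L) (lamSym ρs L) L m`. -/
def corrPsiSym (m : ℕ) (A : Form1 d ℝ) : Form1 d ℝ := corrPsiOf (avSym (fun k => toSite (r k)) L) (lamSym (fun k => toSite (r k)) L) L m A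

/-- [folklore] `Φˢ_m` unfolded (`rfl`). -/
theorem corrPhiSym_eq (m : ℕ) (A : Form1 d ℝ) :
    corrPhiSym r L m A = A - ((box d (L ^ m)).card : ℝ)⁻¹ • dz (ext (L ^ m) (compDefectSymAt (fun k => toSite (r k)) L m A)) := rfl

/-- [folklore] `Ψˢ_m` unfolded (`rfl`). -/
theorem corrPsiSym_eq (m : ℕ) (A : Form1 d ℝ) :
    corrPsiSym r L m A = A + ((box d (L ^ m)).card : ℝ)⁻¹ • dz (ext (L ^ m) (compDefectSymAt (fun k => toSite (r k)) L m A)) := rfl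

variable {L} (hL : 0 < L) (hr : ∀ k, r k ∈ box d L)
include hL hr

/-- [folklore] **THE (0.4) CORRECTORS ARE MUTUALLY INVERSE (I)**: `Ψˢ_m (Φˢ_m A) = A` (in-block roots, `0 < L`). -/
theorem corrPsiSym_corrPhiSym (m : ℕ) (A : Form1 d ℝ) : corrPsiSym r L m (corrPhiSym r L m A) = A :=
  corrPsiOf_corrPhiOf (avSym_sub _ L) (lamSym_sub _ L) (fun k j g => avSym_dz_ext_succ hL r hr k j g) (fun k j g => zetaS_dz_ext_succ hL (hr k) j g) m A

/-- [folklore] **THE (0.4) CORRECTORS ARE MUTUALLY INVERSE (II)**: `Φˢ_m (Ψˢ_m A) = A`. -/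
theorem corrPhiSym_corrPsiSym (m : ℕ) (A : Form1 d ℝ) : corrPhiSym r L m (corrPsiSym r L m A) = A :=
  corrPhiOf_corrPsiOf (avSym_sub _ L) (lamSym_sub _ L) (fun k j g => avSym_dz_ext_succ hL r hr k j g) (fun k j g => zetaS_dz_ext_succ hL (hr k) j g) m A

omit hr in
/-- [folklore] **RE-LINEARISATION**: `contourSum (L^m) (Φˢ_m A) = compLinAvgSymAt ρs L m A` — the straight block-`L^m` row of the (0.4)-corrected field IS the m-fold composite (0.4)
linear average (the form-level half of XREAD-L's null row: the congruence border's rows are the (0.4) composite rows). -/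
theorem contourSum_corrPhiSym (m : ℕ) (A : Form1 d ℝ) : contourSum (L ^ m) (corrPhiSym r L m A) = compLinAvgSymAt (fun k => toSite (r k)) L m A :=
  contourSum_corrPhiOf hL (contourSum_sub_avSym _ L) m A

omit hL hr in
/-- [folklore] SLICE PRESERVATION (Φˢ). -/
theorem axialGaugeAt_corrPhiSym_sub (m : ℕ) {s : Fin d → ℕ} (hs : s ∈ box d (L ^ m)) (A : Form1 d ℝ) :
    AxialGaugeAt (toSite s) (corrPhiSym r L m A - A) (L ^ m) :=
  axialGaugeAt_corrPhiOf_sub _ _ L m hs A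

omit hL hr in
/-- [folklore] SLICE PRESERVATION (Ψˢ). -/
theorem axialGaugeAt_corrPsiSym_sub (m : ℕ) {s : Fin d → ℕ} (hs : s ∈ box d (L ^ m)) (A : Form1 d ℝ) :
    AxialGaugeAt (toSite s) (corrPsiSym r L m A - A) (L ^ m) :=
  axialGaugeAt_corrPsiOf_sub _ _ L m hs A

omit hL hr in
/-- [folklore] FLATNESS (Φˢ). -/
theorem curv_corrPhiSym (m : ℕ) (A : Form1 d ℝ) : curv (corrPhiSym r L m A) = curv A := curv_corrPhiOf _ _ L m A

omit hL hr in
/-- [folklore] FLATNESS (Ψˢ). -/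
theorem curv_corrPsiSym (m : ℕ) (A : Form1 d ℝ) : curv (corrPsiSym r L m A) = curv A := curv_corrPsiOf _ _ L m A

end Sym

end

end Summit.QuantumFields.BalabanUV.Beta.CompositeAveragingCoarseExactGeneric
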